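import Literature.NumberTheory.EllipticCurves.Rank1Residual.X1RankOneOddPrime
import Literature.NumberTheory.EllipticCurves.Rank1Residual.ClassX1KellerYinTypeA
import Literature.NumberTheory.EllipticCurves.KellerYin2024.AnomalousBSD
import Literature.NumberTheory.EllipticCurves.Rank1Residual.ClassX1KellerYinCertificate
import HarnessLib

/-!
# Class X1: Keller–Yin's rank-one display IMPLIES Mazur's cyclotomic main conjecture at every
# rank-one X1 pair carrying the Schneider certificate (theorems only)

`Proofs` companion (theorems only; no definition, no named fact — D-0014/D-0026) of
`KellerYin2024/AnomalousBSD` (the OPEN hypothesis `thm421_rankOne_display_OPEN`: T. Keller, M. Yin,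
arXiv:2402.12781v2, proof of Thm. 4.2.1, p. 22 — an unrefereed preprint, NEVER cited as a theorem),
`Rank1Residual/ClassX1KellerYinTypeA` (prover A, gen 1: the display gives Miller's `BSD(E,p)` on
X1 ∩ {r = 1, type A} from PUBLISHED facts) and `Rank1Residual/X1RankOneOddPrime` (prover B, gen 4:
at every rank-one X1 pair, modulo the Schneider certificate, Mazur's main conjecture for `(E,p)` ⟺
`BSD(E,p)`, from Wuthrich 2014 Thm. 16, Perrin-Riou–Schneider, Perrin-Riou 1987, the Mazur–Tate sigma
function, modularity and Gross–Zagier–Kolyvagin — every `p` of the class, `p = 3` included).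

HONEST FRAMING (BSD rank-≤1 residual cell `b2b-bsdres`, home `run/shared/lean/b2b/bsd-rank1-residual/`,
unit `b2b-bsdres-x1a`, prover A = the Keller–Yin route, GEN 4): the goal of the cell is to DELETE the
COMBINATION-SHAPED residual classes for ALL analytic-rank `≤ 1` curves over `ℚ` — "full BSD formula for
every rank `≤ 1` curve in class C" assembled STRICTLY from published theorems — so that the rank-`≤ 1`
remainder becomes exactly the CONSTRUCTION-SHAPED classes, which are TYPED (missing-input `Prop`s), NOT
attempted; this is not "finishing BSD". Nothing here closes X1; this file only makes precise what the
announced preprint would buy ON THE CYCLOTOMIC SIDE.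

## What is proved

Keller–Yin do NOT state a cyclotomic main conjecture: §0.5 of arXiv:2402.12781v2 says only that their
results "would automatically generalize the results which require the main theorem in [CGLS] as an
input, for example [CGS]" (Castella–Grossi–Skinner 2025, Thm. A = Thm. 7.1.1 [LaTeXML v1 "Thm. 1"] =
Mazur's main conjecture at Eisenstein
primes with `φ|_{G_p} ≠ 1, ω`, i.e. NON-anomalous), and M. Yin (arXiv:2410.24193, after Conj. 0.2.4)
asserts the anomalous case in prose. The theorems below show that, ON THE PUBLISHED RECORD, their
rank-one theorem (the display of p. 22) already IMPLIES Mazur's main conjecture `char_Λ X(E/ℚ_∞) =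
(ϖ · L_p(f, α))` at every anomalous Eisenstein pair `(E, p)` with `ord_{s=1} L(E,s) = 1` whose canonical
cyclotomic `p`-adic height is non-degenerate (Schneider 1985; certified per pair by a finite `p`-adic
computation):

* `X1.mainConjecture_of_KY_OPEN_of_not_gvPar_of_analyticRank_eq_one` — parity type A (`¬ GVPar W p`;
  e.g. a rational point of order `p` in the isogeny class): display ⟹ `BSD(E,p)` (gen 1, with
  Greenberg–Vatsal for the type-B partner twist, Greenberg Thm. 4.1, Hoffstein–Luo, Gross–Zagier I.7.3,
  GZK, modularity) ⟹ main conjecture (prover B's iff, `.mpr`);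
* `X1.mainConjecture_of_KY_OPEN_of_analyticRank_eq_one` — any parity: type B is Greenberg–Vatsal 2000
  Thm. 1.3 outright (no display, no certificate), type A the previous theorem;
* `X1.bsdp_iff_mainConjecture_of_KY_OPEN_of_not_gvPar` — bookkeeping form: under the display, at a
  type-A rank-one X1 pair with the certificate BOTH `BSD(E,p)` and the main conjecture hold, so the
  preprint's rank-one content and the (unstated) cyclotomic main conjecture coincide there.

So of the two typed open inputs of X1 (`Rank1ResidualX1Defs`: Keller–Yin's display — announced — and
Mazur's main conjecture on type A — unstated), the first implies the rank-one half of the second modulo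
the certificate; only the RANK-ZERO type-A main conjecture is untouched by the preprint's written proof
(its rank-zero clause of Thm. 4.2.1 rests on the §0.5 prose claim, X1-CHAIN §2 L10).

References: [KellerYin2024] Thm. 4.2.1 and p. 22, §0.5; [CastellaGrossiSkinner2025] Thm. A (= Thm. 7.1.1;
LaTeXML v1 "Thm. 1");
[GreenbergVatsal2000] Thm. (1.3); [Wuthrich2014] Thm. 16, §6; [PerrinRiou1987] §1.4 Cor. 1.8;
[BalakrishnanMullerStein2015] Thm. 1.7; [Balakrishnan2016] §2; [MazurSteinTate2006] Thm. 1.3;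
[Miller2011LMS] Def. 1.1.
-/

set_option autoImplicit false

noncomputable section

open scoped Classical MatrixGroups ModularForm

open CongruenceSubgroup WeierstrassCurve Literature.NumberTheory.EllipticCurves
  Literature.NumberTheory.EllipticCurves.ModularForms
  Literature.NumberTheory.EllipticCurves.Wuthrich2014

namespace Literature.NumberTheory.EllipticCurves.Rank1Residual

/-- **Keller–Yin's rank-one display ⟹ Mazur's main conjecture at a TYPE-A rank-one X1 pair with
non-degenerate canonical `p`-adic height.** Let `W/ℚ` be globally minimal elliptic and `p` a prime with
`ClassX1 W p` (`2 < p`, `E[p]` reducible, good reduction, anomalous), `¬ GVPar W p` (parity type A),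
`ord_{s=1} L(E,s) = 1`, and Schneider's non-degeneracy for THE canonical cyclotomic `p`-adic height
(`hSch`, the per-pair certificate). OPEN input: `hKY` = `KellerYin2024.thm421_rankOne_display_OPEN`
(arXiv:2402.12781v2, display of p. 22; unrefereed — taken as a hypothesis, never as a theorem).
PUBLISHED named facts: Greenberg–Vatsal 2000 Thm. 1.3 (`hGV`), Greenberg 1999 Thm. 4.1 (`hGr`),
modularity (`hmodP`, `hmod`), Hoffstein–Luo 1997 (`hHL`), Gross–Zagier 1986 Thm. I.7.3 (`hGZ`),
Gross–Zagier–Kolyvagin (`hGZK`), Wuthrich 2014 Thm. 16 (`hW16`), Perrin-Riou–Schneider as printed by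
Balakrishnan–Müller–Stein 2016 Thm. 1.7, `p > 2` (`hS`), Perrin-Riou 1987 §1.4 Cor. 1.8, `p` odd (`hPR`),
the Mazur–Tate sigma function at odd `p` (`hMT`). Conclusion: Mazur's main conjecture for `(E, p)` in
the Néron normalisation (literally the body of `Summit.…Rank1ResidualX1Defs.MazurMainConjecture W p`).
Proof: the display gives `BSDp W p` (`bsdp_of_classX1_typeA_of_analyticRank_eq_one_of_KY_OPEN`), and at
a rank-one X1 pair with the certificate `BSDp W p` is equivalent to the main conjecture
(`X1.mainConjecture_iff_bsdp_of_analyticRank_eq_one`, prover B gen 4).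
[cite: KellerYin2024, Thm. 4.2.1 and its proof (p. 22); §0.5 (prose claim only)]
[cite: GreenbergVatsal2000, Thm. (1.3)] [cite: Wuthrich2014, Thm. 16 (p. 393) and §6 (p. 400)]
[cite: PerrinRiou1987, §1.4 Cor. 1.8] [cite: BalakrishnanMullerStein2015, Thm. 1.7] -/
theorem X1.mainConjecture_of_KY_OPEN_of_not_gvPar_of_analyticRank_eq_one
    (hKY : KellerYin2024.thm421_rankOne_display_OPEN)
    (hGV : GreenbergVatsal2000.thm13_charIdeal_eq_of_gvPar) (hGr : greenberg_charValue_rankZero)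
    (hmodP : nonempty_modularParametrizationData) (hmod : exists_isNewformOf)
    (hHL : HoffsteinLuo1997_exists_twist_L_one_ne_zero) (hGZ : GrossZagier1986_thm_I_7_3)
    (hGZK : rank_eq_analyticRank_of_analyticRank_le_one)
    (hW16 : charIdeal_dvd_padicLFunction) (hS : Schneider1985_order_charGenerator_odd)
    (hPR : perrinRiou_rankOne_leadingTerms_odd) (hMT : mazur_tate_sigma_exists_odd)
    (W : WeierstrassCurve ℚ) [W.IsElliptic] [W.IsGloballyMinimal] (p : ℕ) [Fact p.Prime]
    (hX1 : ClassX1 W p) (hA : ¬ GVPar W p) (hr : W.analyticRank = 1)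
    (hSch : ∀ Dh : PAdicHeightData W p, Dh.IsCanonical → SchneiderConjecture Dh) :
    ∀ (κ : ZpExtension ℚ p) (γ : Field.absoluteGaloisGroup ℚ),
        κ.IsCyclotomic → κ.IsTopGenerator γ → IsCyclotomicVariable p γ →
      ∀ [NeZero (W.conductorNorm ℤ)] (f : CuspForm (Gamma0 (W.conductorNorm ℤ)) 2),
        IsNewformOf W f → ∀ (ϖ : ℚ), (ϖ : ℝ) * W.realPeriodRat = plusPeriod f →
      ∀ (D : W.SelmerDualData κ γ), D.IsTorsion ∧
        ∃ g : IwasawaAlgebra p, D.charIdeal = Ideal.span {g} ∧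
          iwasawaToPowerSeries p g =
            PowerSeries.C (ϖ : ℚ_[p]) * padicLFunction f (unitRoot W p : ℚ_[p]) :=
  (X1.mainConjecture_iff_bsdp_of_analyticRank_eq_one hW16 hS hPR hMT hmodP hGZK W p hX1 hr hSch).mpr
    (bsdp_of_classX1_typeA_of_analyticRank_eq_one_of_KY_OPEN hGV hGr hmodP hmod hHL hGZ hGZK W p hX1
      hA hr hKY)

/-- **Keller–Yin's rank-one display ⟹ Mazur's main conjecture at EVERY rank-one X1 pair with the
certificate, either parity.** Type B (`GVPar W p`) is Greenberg–Vatsal 2000 Thm. 1.3 (+ Kato) outright —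
neither the display nor the certificate is used there; type A is
`X1.mainConjecture_of_KY_OPEN_of_not_gvPar_of_analyticRank_eq_one`. Same inputs.
[cite: KellerYin2024, Thm. 4.2.1 and its proof (p. 22)] [cite: GreenbergVatsal2000, Thm. (1.3)]
[cite: Wuthrich2014, Thm. 16 (p. 393) and §6 (p. 400)] -/
theorem X1.mainConjecture_of_KY_OPEN_of_analyticRank_eq_one
    (hKY : KellerYin2024.thm421_rankOne_display_OPEN)
    (hGV : GreenbergVatsal2000.thm13_charIdeal_eq_of_gvPar) (hGr : greenberg_charValue_rankZero)
    (hmodP : nonempty_modularParametrizationData) (hmod : exists_isNewformOf)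
    (hHL : HoffsteinLuo1997_exists_twist_L_one_ne_zero) (hGZ : GrossZagier1986_thm_I_7_3)
    (hGZK : rank_eq_analyticRank_of_analyticRank_le_one)
    (hW16 : charIdeal_dvd_padicLFunction) (hS : Schneider1985_order_charGenerator_odd)
    (hPR : perrinRiou_rankOne_leadingTerms_odd) (hMT : mazur_tate_sigma_exists_odd)
    (W : WeierstrassCurve ℚ) [W.IsElliptic] [W.IsGloballyMinimal] (p : ℕ) [Fact p.Prime]
    (hX1 : ClassX1 W p) (hr : W.analyticRank = 1)
    (hSch : ∀ Dh : PAdicHeightData W p, Dh.IsCanonical → SchneiderConjecture Dh) :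
    ∀ (κ : ZpExtension ℚ p) (γ : Field.absoluteGaloisGroup ℚ),
        κ.IsCyclotomic → κ.IsTopGenerator γ → IsCyclotomicVariable p γ →
      ∀ [NeZero (W.conductorNorm ℤ)] (f : CuspForm (Gamma0 (W.conductorNorm ℤ)) 2),
        IsNewformOf W f → ∀ (ϖ : ℚ), (ϖ : ℝ) * W.realPeriodRat = plusPeriod f →
      ∀ (D : W.SelmerDualData κ γ), D.IsTorsion ∧
        ∃ g : IwasawaAlgebra p, D.charIdeal = Ideal.span {g} ∧
          iwasawaToPowerSeries p g =
            PowerSeries.C (ϖ : ℚ_[p]) * padicLFunction f (unitRoot W p : ℚ_[p]) := by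
  by_cases hpar : GVPar W p
  · -- type B: Greenberg–Vatsal 2000 Thm. 1.3 gives the main conjecture directly
    have hX := isClassX1_of_classX1 hX1
    exact hGV W p hX1.1.ne' hX.hasGoodReductionAtPrime hX.not_dvd_frobeniusTrace hpar
  · exact X1.mainConjecture_of_KY_OPEN_of_not_gvPar_of_analyticRank_eq_one hKY hGV hGr hmodP hmod hHL
      hGZ hGZK hW16 hS hPR hMT W p hX1 hpar hr hSch

/-- **Bookkeeping form: under Keller–Yin's display, at a type-A rank-one X1 pair with the certificate
BOTH `BSD(E,p)` AND Mazur's main conjecture hold** — the preprint's rank-one content and the cyclotomic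
main conjecture coincide there on the published record. Same inputs.
[cite: KellerYin2024, Thm. 4.2.1 and its proof (p. 22); §0.5] [cite: Wuthrich2014, Thm. 16 and §6] -/
theorem X1.bsdp_and_mainConjecture_of_KY_OPEN_of_not_gvPar_of_analyticRank_eq_one
    (hKY : KellerYin2024.thm421_rankOne_display_OPEN)
    (hGV : GreenbergVatsal2000.thm13_charIdeal_eq_of_gvPar) (hGr : greenberg_charValue_rankZero)
    (hmodP : nonempty_modularParametrizationData) (hmod : exists_isNewformOf)
    (hHL : HoffsteinLuo1997_exists_twist_L_one_ne_zero) (hGZ : GrossZagier1986_thm_I_7_3)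
    (hGZK : rank_eq_analyticRank_of_analyticRank_le_one)
    (hW16 : charIdeal_dvd_padicLFunction) (hS : Schneider1985_order_charGenerator_odd)
    (hPR : perrinRiou_rankOne_leadingTerms_odd) (hMT : mazur_tate_sigma_exists_odd)
    (W : WeierstrassCurve ℚ) [W.IsElliptic] [W.IsGloballyMinimal] (p : ℕ) [Fact p.Prime]
    (hX1 : ClassX1 W p) (hA : ¬ GVPar W p) (hr : W.analyticRank = 1)
    (hSch : ∀ Dh : PAdicHeightData W p, Dh.IsCanonical → SchneiderConjecture Dh) :
    BSDp W p ∧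
    ∀ (κ : ZpExtension ℚ p) (γ : Field.absoluteGaloisGroup ℚ),
        κ.IsCyclotomic → κ.IsTopGenerator γ → IsCyclotomicVariable p γ →
      ∀ [NeZero (W.conductorNorm ℤ)] (f : CuspForm (Gamma0 (W.conductorNorm ℤ)) 2),
        IsNewformOf W f → ∀ (ϖ : ℚ), (ϖ : ℝ) * W.realPeriodRat = plusPeriod f →
      ∀ (D : W.SelmerDualData κ γ), D.IsTorsion ∧
        ∃ g : IwasawaAlgebra p, D.charIdeal = Ideal.span {g} ∧
          iwasawaToPowerSeries p g =
            PowerSeries.C (ϖ : ℚ_[p]) * padicLFunction f (unitRoot W p : ℚ_[p]) :=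
  ⟨bsdp_of_classX1_typeA_of_analyticRank_eq_one_of_KY_OPEN hGV hGr hmodP hmod hHL hGZ hGZK W p hX1 hA
      hr hKY,
    X1.mainConjecture_of_KY_OPEN_of_not_gvPar_of_analyticRank_eq_one hKY hGV hGr hmodP hmod hHL hGZ
      hGZK hW16 hS hPR hMT W p hX1 hA hr hSch⟩

/-! ### Appended (gen 4): PER PAIR, Keller–Yin's display instance is EQUIVALENT to `BSD(E,p)`,
and — modulo the Schneider certificate — to Mazur's main conjecture at `(E,p)`

The OPEN hypothesis `thm421_rankOne_display_OPEN` is a `∀`-statement. Below, its INSTANCE at one pair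
`(E, p)`, one auxiliary field `K` and one globally minimal model `Wd` of `E^{(d_K)}` — the identity
"`ord_p(L'(E,1)/(Reg·Ω_E)) − ord_p #Ш(E) − ord_p ∏c_ℓ(E) + 2 ord_p #E(ℚ)_tors = −(same for E^K at
rank 0)`" quantified over the rational values `q`, `qd` of the two normalised leading terms — is shown to
carry EXACTLY the content of Miller's `BSD(E,p)` (given the rank-`0` print shape of the partner, which is
PUBLISHED at a type-A pair: Greenberg–Vatsal for the type-B twist), and hence, at a type-A rank-one X1 pair
with the certificate, exactly the content of Mazur's main conjecture at `(E,p)` (prover B gen 4's iff).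
No parity or admissibility hypothesis is needed for the bookkeeping directions. -/

/-- **Display instance + partner print shape ⟹ `BSD(E,p)`** (per pair; the deduction of
`bsdp_of_classX1_of_analyticRank_eq_one_of_KY_OPEN_at` with the `∀`-hypothesis replaced by its instance).
For `W/ℚ` globally minimal elliptic, `p` prime, `ord_{s=1} L(E,s) = 1`, ANY globally minimal elliptic
`Wd` with the rank-`0` print shape `PPartRankZero Wd p`, and the Keller–Yin identity between the
`p`-adic valuations of the normalised leading terms of `W` and `Wd` (`hdisp`): `BSDp W p`. PUBLISHED
inputs: modularity (`hmod`), Gross–Zagier 1986 Thm. I.7.3 (`hGZ`: `L'(E,1)/(Ω Reg) ∈ ℚ`),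
Gross–Zagier–Kolyvagin (`hGZK`). [cite: KellerYin2024, proof of Thm. 4.2.1 (p. 22), the display]
[cite: GrossZagier1986, Thm. I.7.3] [cite: Miller2011LMS, Def. 1.1 (arXiv:1010.2431 p. 3)] -/
theorem bsdp_of_display_at_of_pPartRankZero
    (hmod : exists_isNewformOf) (hGZ : GrossZagier1986_thm_I_7_3)
    (hGZK : rank_eq_analyticRank_of_analyticRank_le_one)
    (W : WeierstrassCurve ℚ) [W.IsElliptic] [W.IsGloballyMinimal] (p : ℕ) [Fact p.Prime]
    (hr : W.analyticRank = 1)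
    (Wd : WeierstrassCurve ℚ) [Wd.IsElliptic] [Wd.IsGloballyMinimal] (hpartner : PPartRankZero Wd p)
    (hdisp : ∀ (q qd : ℚ), W.leadingLCoeff / ((W.realPeriodRat * W.regulator : ℝ) : ℂ) = (q : ℂ) →
        Wd.entireLFunction 1 / (Wd.realPeriodRat : ℂ) = (qd : ℂ) →
        padicValRat p q - ((padicValNat p W.shaOrder : ℤ) + padicValNat p W.tamagawaProduct -
            2 * padicValNat p W.torsionOrder) =
          -(padicValRat p qd - ((padicValNat p Wd.shaOrder : ℤ) + padicValNat p Wd.tamagawaProduct -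
            2 * padicValNat p Wd.torsionOrder))) :
    BSDp W p := by
  -- adapted from `bsdp_of_classX1_of_analyticRank_eq_one_of_KY_OPEN_at` (x1a gen 2)
  obtain ⟨hrank, -⟩ := hGZK W (by omega)
  have hrk : W.mordellWeilRank = 1 := by omega
  obtain ⟨q, -, hqL⟩ := leadingLCoeff_eq_rat_mul_of_analyticRank_eq_one (W := W) hGZ hr hrk
  have hΩ : (0 : ℝ) < W.realPeriodRat := W.realPeriodRat_pos_holds
  have hR : (0 : ℝ) < W.regulator := W.regulator_pos'
  have hΩR : ((W.realPeriodRat * W.regulator : ℝ) : ℂ) ≠ 0 := by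
    exact_mod_cast (mul_pos hΩ hR).ne'
  have hq : W.leadingLCoeff / ((W.realPeriodRat * W.regulator : ℝ) : ℂ) = (q : ℂ) := by
    rw [div_eq_iff hΩR, hqL]
    push_cast
    ring
  obtain ⟨qd, hqd, hvd⟩ := hpartner
  have hv : padicValRat p q = (padicValNat p W.shaOrder : ℤ) + padicValNat p W.tamagawaProduct -
      2 * padicValNat p W.torsionOrder := by
    have h := hdisp q qd hq hqd
    rw [hvd] at h
    linarith
  exact bsdp_of_pPart W p (WeierstrassCurve.hasEntireLFunction_rat_of_exists_isNewformOf hmod) hGZK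
    (by omega) ⟨q, hq, hv⟩

/-- **Conversely, `BSD(E,p)` + partner print shape ⟹ the display instance** (both sides of the identity
vanish). For `W/ℚ` globally minimal elliptic with `ord_{s=1} L(E,s) ≤ 1` and `BSDp W p`, and any globally
minimal elliptic `Wd` with `PPartRankZero Wd p`: the Keller–Yin identity holds for every pair of rational
values `q`, `qd` (which are unique: `ℚ → ℂ` is injective). Inputs: modularity (`hmod`), GZK (`hGZK`), via
the bridge `pPart_of_bsdp`. [cite: KellerYin2024, proof of Thm. 4.2.1 (p. 22), the display]
[cite: Miller2011LMS, Def. 1.1 (arXiv:1010.2431 p. 3)] -/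
theorem display_at_of_bsdp_of_pPartRankZero
    (hmod : exists_isNewformOf) (hGZK : rank_eq_analyticRank_of_analyticRank_le_one)
    (W : WeierstrassCurve ℚ) [W.IsElliptic] [W.IsGloballyMinimal] (p : ℕ) [Fact p.Prime]
    (hr : W.analyticRank ≤ 1) (hB : BSDp W p)
    (Wd : WeierstrassCurve ℚ) [Wd.IsElliptic] [Wd.IsGloballyMinimal] (hpartner : PPartRankZero Wd p) :
    ∀ (q qd : ℚ), W.leadingLCoeff / ((W.realPeriodRat * W.regulator : ℝ) : ℂ) = (q : ℂ) →
        Wd.entireLFunction 1 / (Wd.realPeriodRat : ℂ) = (qd : ℂ) →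
        padicValRat p q - ((padicValNat p W.shaOrder : ℤ) + padicValNat p W.tamagawaProduct -
            2 * padicValNat p W.torsionOrder) =
          -(padicValRat p qd - ((padicValNat p Wd.shaOrder : ℤ) + padicValNat p Wd.tamagawaProduct -
            2 * padicValNat p Wd.torsionOrder)) := by
  intro q qd hq hqd
  obtain ⟨q0, hq0, hv0⟩ :=
    pPart_of_bsdp (WeierstrassCurve.hasEntireLFunction_rat_of_exists_isNewformOf hmod) hGZK W p hr hB
  obtain ⟨qd0, hqd0, hvd0⟩ := hpartner
  have h1 : q = q0 := by
    have : (q : ℂ) = (q0 : ℂ) := by rw [← hq, hq0]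
    exact_mod_cast this
  have h2 : qd = qd0 := by
    have : (qd : ℂ) = (qd0 : ℂ) := by rw [← hqd, hqd0]
    exact_mod_cast this
  subst h1 h2
  rw [hv0, hvd0]
  ring

/-- **PER PAIR, at a TYPE-A rank-one X1 pair: Keller–Yin's display instance ⟺ `BSD(E,p)`** (no
certificate). Let `W/ℚ` be globally minimal elliptic, `ClassX1 W p`, `¬ GVPar W p`, `ord_{s=1} L(E,s) = 1`,
`K` an imaginary quadratic field with odd discriminant in which `p` splits and `L(E^{(d_K)},1) ≠ 0`, `Wd` a
globally minimal model of the twist `E^{(d_K)}`. The partner print shape `PPartRankZero Wd p` is PUBLISHED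
here (`pPartRankZero_twist_of_not_gvPar`: the twist is of type B at the good ordinary prime `p`, so
Greenberg–Vatsal 2000 Thm. 1.3 + Greenberg Thm. 4.1 + Mazur–Swinnerton-Dyer give it), whence the display
instance for `(W, p, Wd)` holds iff `BSDp W p`. [cite: KellerYin2024, proof of Thm. 4.2.1 (p. 22)]
[cite: GreenbergVatsal2000, Thm. (1.3)] [cite: GreenbergLNM1716, Thm. 4.1]
[cite: Miller2011LMS, Def. 1.1 (arXiv:1010.2431 p. 3)] -/
theorem display_at_iff_bsdp_of_not_gvPar
    (hGV : GreenbergVatsal2000.thm13_charIdeal_eq_of_gvPar) (hGr : greenberg_charValue_rankZero)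
    (hmodP : nonempty_modularParametrizationData) (hmod : exists_isNewformOf)
    (hGZ : GrossZagier1986_thm_I_7_3) (hGZK : rank_eq_analyticRank_of_analyticRank_le_one)
    (W : WeierstrassCurve ℚ) [W.IsElliptic] [W.IsGloballyMinimal] (p : ℕ) [Fact p.Prime]
    (hX1 : ClassX1 W p) (hA : ¬ GVPar W p) (hr : W.analyticRank = 1)
    (K : Type) [Field K] [NumberField K] (hK : IsImaginaryQuadratic K)
    (hodd : Odd (NumberField.discr K)) (hsplit : SatisfiesHeegnerHypothesis p K)
    (hLK : (W.quadraticTwist (NumberField.discr K : ℚ)).entireLFunction 1 ≠ 0)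
    (Wd : WeierstrassCurve ℚ) [Wd.IsElliptic] [Wd.IsGloballyMinimal]
    (hWd : ∃ C : VariableChange ℚ, C • Wd = W.quadraticTwist (NumberField.discr K : ℚ)) :
    (∀ (q qd : ℚ), W.leadingLCoeff / ((W.realPeriodRat * W.regulator : ℝ) : ℂ) = (q : ℂ) →
        Wd.entireLFunction 1 / (Wd.realPeriodRat : ℂ) = (qd : ℂ) →
        padicValRat p q - ((padicValNat p W.shaOrder : ℤ) + padicValNat p W.tamagawaProduct -
            2 * padicValNat p W.torsionOrder) =
          -(padicValRat p qd - ((padicValNat p Wd.shaOrder : ℤ) + padicValNat p Wd.tamagawaProduct -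
            2 * padicValNat p Wd.torsionOrder))) ↔
    BSDp W p := by
  have hpartner : PPartRankZero Wd p :=
    pPartRankZero_twist_of_not_gvPar hGV hGr hmodP hGZK W p hX1 hA K hK hodd hsplit hLK Wd hWd
  exact ⟨fun hdisp ↦ bsdp_of_display_at_of_pPartRankZero hmod hGZ hGZK W p hr Wd hpartner hdisp,
    fun hB ↦ display_at_of_bsdp_of_pPartRankZero hmod hGZK W p (by omega) hB Wd hpartner⟩

/-- **PER PAIR, at a TYPE-A rank-one X1 pair carrying the Schneider certificate: Keller–Yin's display
instance ⟺ Mazur's main conjecture at `(E, p)`.** Same setting as `display_at_iff_bsdp_of_not_gvPar`,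
plus the certificate `hSch` and the PUBLISHED inputs of prover B's iff (`hW16` Wuthrich Thm. 16, `hS`
Perrin-Riou–Schneider at odd `p`, `hPR` Perrin-Riou 1987 at odd `p`, `hMT` Mazur–Tate sigma at odd `p`).
So the announced anticyclotomic theorem and the unstated cyclotomic main conjecture have, pair by pair,
the SAME content on the published record. [cite: KellerYin2024, proof of Thm. 4.2.1 (p. 22); §0.5]
[cite: Wuthrich2014, Thm. 16 (p. 393) and §6 (p. 400)] [cite: PerrinRiou1987, §1.4 Cor. 1.8]
[cite: BalakrishnanMullerStein2015, Thm. 1.7] [cite: GreenbergVatsal2000, Thm. (1.3)] -/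
theorem display_at_iff_mainConjecture_of_not_gvPar
    (hGV : GreenbergVatsal2000.thm13_charIdeal_eq_of_gvPar) (hGr : greenberg_charValue_rankZero)
    (hmodP : nonempty_modularParametrizationData) (hmod : exists_isNewformOf)
    (hGZ : GrossZagier1986_thm_I_7_3) (hGZK : rank_eq_analyticRank_of_analyticRank_le_one)
    (hW16 : charIdeal_dvd_padicLFunction) (hS : Schneider1985_order_charGenerator_odd)
    (hPR : perrinRiou_rankOne_leadingTerms_odd) (hMT : mazur_tate_sigma_exists_odd)
    (W : WeierstrassCurve ℚ) [W.IsElliptic] [W.IsGloballyMinimal] (p : ℕ) [Fact p.Prime]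
    (hX1 : ClassX1 W p) (hA : ¬ GVPar W p) (hr : W.analyticRank = 1)
    (hSch : ∀ Dh : PAdicHeightData W p, Dh.IsCanonical → SchneiderConjecture Dh)
    (K : Type) [Field K] [NumberField K] (hK : IsImaginaryQuadratic K)
    (hodd : Odd (NumberField.discr K)) (hsplit : SatisfiesHeegnerHypothesis p K)
    (hLK : (W.quadraticTwist (NumberField.discr K : ℚ)).entireLFunction 1 ≠ 0)
    (Wd : WeierstrassCurve ℚ) [Wd.IsElliptic] [Wd.IsGloballyMinimal]
    (hWd : ∃ C : VariableChange ℚ, C • Wd = W.quadraticTwist (NumberField.discr K : ℚ)) :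
    (∀ (q qd : ℚ), W.leadingLCoeff / ((W.realPeriodRat * W.regulator : ℝ) : ℂ) = (q : ℂ) →
        Wd.entireLFunction 1 / (Wd.realPeriodRat : ℂ) = (qd : ℂ) →
        padicValRat p q - ((padicValNat p W.shaOrder : ℤ) + padicValNat p W.tamagawaProduct -
            2 * padicValNat p W.torsionOrder) =
          -(padicValRat p qd - ((padicValNat p Wd.shaOrder : ℤ) + padicValNat p Wd.tamagawaProduct -
            2 * padicValNat p Wd.torsionOrder))) ↔
    ∀ (κ : ZpExtension ℚ p) (γ : Field.absoluteGaloisGroup ℚ),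
        κ.IsCyclotomic → κ.IsTopGenerator γ → IsCyclotomicVariable p γ →
      ∀ [NeZero (W.conductorNorm ℤ)] (f : CuspForm (Gamma0 (W.conductorNorm ℤ)) 2),
        IsNewformOf W f → ∀ (ϖ : ℚ), (ϖ : ℝ) * W.realPeriodRat = plusPeriod f →
      ∀ (D : W.SelmerDualData κ γ), D.IsTorsion ∧
        ∃ g : IwasawaAlgebra p, D.charIdeal = Ideal.span {g} ∧
          iwasawaToPowerSeries p g =
            PowerSeries.C (ϖ : ℚ_[p]) * padicLFunction f (unitRoot W p : ℚ_[p]) :=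
  (display_at_iff_bsdp_of_not_gvPar hGV hGr hmodP hmod hGZ hGZK W p hX1 hA hr K hK hodd hsplit hLK Wd
      hWd).trans
    (X1.mainConjecture_iff_bsdp_of_analyticRank_eq_one hW16 hS hPR hMT hmodP hGZK W p hX1 hr hSch).symm

end Literature.NumberTheory.EllipticCurves.Rank1Residual

end
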